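import Literature.Analysis.FluidPDE.TaylorGreenVortex
import Literature.Analysis.FluidPDE.TsaiSelfSimilarBounded
import HarnessLib

/-!
# Barrier: the Navier–Stokes pressure is SLAVED to the velocity (`−Δp = div((u·∇)u) = tr (∇u)²`) and
# has no gauge freedom beyond constants in the decaying class — «p ≡ 0 / p harmonic / p prescribed
# without loss of generality» reduces NS to a pressureless (Burgers-type) system that is no longer NS

Catalogue entry (kind (c), method-level lemma; cell ns-claims, D-0090; technique rows «pressure
elimination» — setting `p = 0` or `p = const` «без ограничения общности», declaring `Δp = 0` for all
flows (e.g. after a change to Lagrangian variables), absorbing `∇p` into a prescribed potential, or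
solving a pressureless system and calling the result a Navier–Stokes solution), salvage seat
ns-claims-salvage-p1. Everything below is PROVED (zero fact debt): the tree's Taylor–Green vortex
`Literature.Analysis.FluidPDE.TaylorGreenVortex` (closed-form `div((u·∇)u)`, Poisson pressure) and
Liouville's theorem for bounded harmonic functions `isConst_of_harmonic_bounded`.

WHY THE PRESSURE CANNOT BE GAUGED AWAY. Taking the divergence of the momentum equation of a
divergence-free classical solution gives the pressure Poisson law `−Δp = div((u·∇)u) = Σᵢⱼ ∂ᵢuⱼ∂ⱼuᵢ`
[cite: MajdaBertozziCUP2002, §1.8 (1.84)] (tree: `laplacian_pressure_eq_of_isClassicalNSSolutionOn`,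
`divergence_convect_self_eq`). The right-hand side is a pointwise quadratic functional of `∇u` that does
NOT vanish for generic divergence-free fields — kernel: for the Taylor–Green datum
`u = (sin x cos y cos z, −cos x sin y cos z, 0)`, `div((u·∇)u)(0) = 2` (`divergence_convect_taylorGreen_origin`),
so EVERY `C²` scalar `q` balancing the divergence of the momentum equation at that datum has
`Δq(0) = −2` (`laplacian_eq_neg_two_of_balances`), in particular no harmonic — a fortiori no zero or
constant — pressure is compatible with it (`not_exists_harmonic_pressure_taylorGreen`). And in the
decaying class the pressure is UNIQUE: two bounded solutions of the same Poisson equation tending to `0`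
at infinity coincide (`eq_of_laplacian_eq_of_tendsto_zero`, Liouville [cite: GilbargTrudinger2001, Thm 2.10]);
the only freedom is an additive constant in `x` (a function of `t`), Tao's normalisation
(tree `tao_pressure_normalisation`, `NormalisedPressure*`). What survives after setting `p ≡ 0` is the
pressureless system `∂ₜv + (v·∇)v = νΔv` — a different PDE (vector Burgers), which enjoys a maximum
principle precisely because the non-local pressure force is gone, and whose solutions leave the
divergence-free class (`∂ₜ div v = −tr (∇v)² ≠ 0` at the Taylor–Green datum, `divFree_not_preserved_formal`).

Cell record: instance under adjudication = claim C113 `Baev2022` (Проблемы динамического управления 71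
(2022) 4–23: (12) p.8 «Δ(p + u) = 0», Cor. 1 (15) p.9 / Thm 3 p.15 «p = const … положим p = 0»,
Cor. 2 p.10 «(v,∇)v = 0»; skeleton `Literature.Claims.NS.Baev2022`, Steps `Eq12`, `Cor2`,
`DivFreePersists`); the same device recurs in «exact general solution» rows that absorb `∇p` into a
Bernoulli-type potential. This entry is the METHOD-level statement; it is independent of, and does not
pre-empt, the cell's verdict of record (posted on the MAP, not here).

WHAT THIS IS NOT: not a claim about NS regularity or blow-up; not a claim about any author beyond the typed
locator.
-/

noncomputable section

open Real Set Filter Topology InnerProductSpace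
open scoped Laplacian ContDiff

namespace Literature.Barriers.NavierStokesRegularity

namespace PressureSlaving

open Literature.Analysis.FluidPDE Literature.Analysis.FluidPDE.TaylorGreenVortex

/-- **The source term does not vanish**: for the Taylor–Green datum, `div((u·∇)u)(0) = 2`.
[cite: TaylorGreen1937, eqs. (15)–(16)] -/
theorem divergence_convect_taylorGreen_origin :
    VectorCalculus.divergence (convect velocity velocity) 0 = 2 := by
  rw [divergence_convect_velocity]
  simp
  norm_num

/-- **The Poisson pressure of the Taylor–Green datum is not harmonic**: `Δp(0) = −2`.
[cite: TaylorGreen1937, eqs. (16)–(17)] -/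
theorem laplacian_pressure_taylorGreen_origin : (Δ pressure) 0 = -2 := by
  rw [laplacian_pressure]
  simp
  norm_num

/-- **Every momentum-compatible pressure is non-harmonic at the Taylor–Green datum**: if `q ∈ C²`
balances the divergence of the momentum equation, `div((u·∇)u + ∇q) ≡ 0` (the divergence-free velocity
makes `div ∂ₜu = div Δu = 0`), then `Δq(0) = −2`. [cite: MajdaBertozziCUP2002, §1.8 (1.84)] -/
theorem laplacian_eq_neg_two_of_balances {q : EuclideanSpace ℝ (Fin 3) → ℝ} (hq : ContDiff ℝ 2 q)
    (hbal : ∀ x, VectorCalculus.divergence (fun y => convect velocity velocity y + gradient q y) x = 0) :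
    (Δ q) 0 = -2 := by
  have hc : DifferentiableAt ℝ (convect velocity velocity) 0 := by
    have h1 : ContDiff ℝ 1 (convect velocity velocity) := by
      have e : convect velocity velocity = fun x => fderiv ℝ velocity x (velocity x) := rfl
      rw [e]
      exact ((contDiff_velocity (n := 2)).fderiv_right (m := 1) (by norm_cast)).clm_apply
        (contDiff_velocity (n := 1))
    exact (h1.differentiable one_ne_zero) 0
  have hg : DifferentiableAt ℝ (gradient q) 0 := by
    haveI : CompleteSpace (EuclideanSpace ℝ (Fin 3)) := inferInstance
    have h1 : ContDiff ℝ 1 (gradient q) := by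
      have e : gradient q = fun y => (InnerProductSpace.toDual ℝ _).symm (fderiv ℝ q y) := rfl
      rw [e]
      exact (InnerProductSpace.toDual ℝ (EuclideanSpace ℝ (Fin 3))).symm.toContinuousLinearEquiv.contDiff.comp
        (hq.fderiv_right (m := 1) (by norm_cast))
    exact (h1.differentiable one_ne_zero) 0
  have h := hbal 0
  rw [divergence_add_apply hc hg, divergence_gradient hq, divergence_convect_taylorGreen_origin] at h
  linarith

/-- **No harmonic (hence no zero, no constant) pressure balances the Taylor–Green datum.**
[cite: MajdaBertozziCUP2002, §1.8 (1.84)] -/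
theorem not_exists_harmonic_pressure_taylorGreen :
    ¬ ∃ q : EuclideanSpace ℝ (Fin 3) → ℝ, ContDiff ℝ 2 q ∧ (∀ x, (Δ q) x = 0) ∧
      ∀ x, VectorCalculus.divergence (fun y => convect velocity velocity y + gradient q y) x = 0 := by
  rintro ⟨q, hq, hharm, hbal⟩
  have h := laplacian_eq_neg_two_of_balances hq hbal
  rw [hharm 0] at h
  norm_num at h

/-- **Pressureless dynamics leave the divergence-free class (formal first time-derivative)**: at the
Taylor–Green datum the pressureless right-hand side `νΔu − (u·∇)u` has divergence `−2 ≠ 0` at the origin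
(`div Δu = 0` since `Δu = −3u` is divergence free), so `∂ₜ(div v)|_{t=0} ≠ 0` for the system
`∂ₜv + (v·∇)v = νΔv` started at `u`. [cite: TaylorGreen1937, eqs. (14)–(16)] -/
theorem divFree_not_preserved_formal (ν : ℝ) :
    VectorCalculus.divergence (fun y => ν • (Δ velocity) y - convect velocity velocity y) 0 = -2 := by
  have hΔ : (fun y => ν • (Δ velocity) y) = fun y => (-(3 * ν)) • velocity y := by
    funext y
    rw [laplacian_velocity, smul_smul]
    congr 1
    ring
  have hc : DifferentiableAt ℝ (convect velocity velocity) 0 := by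
    have h1 : ContDiff ℝ 1 (convect velocity velocity) := by
      have e : convect velocity velocity = fun x => fderiv ℝ velocity x (velocity x) := rfl
      rw [e]
      exact ((contDiff_velocity (n := 2)).fderiv_right (m := 1) (by norm_cast)).clm_apply
        (contDiff_velocity (n := 1))
    exact (h1.differentiable one_ne_zero) 0
  have hv : DifferentiableAt ℝ (fun y => ν • (Δ velocity) y) 0 := by
    rw [hΔ]; exact (differentiable_velocity 0).const_smul (-(3 * ν))
  rw [divergence_sub_apply hv hc, hΔ, divergence_const_smul_apply (differentiable_velocity 0),
    isDivFree_velocity 0, divergence_convect_taylorGreen_origin]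
  ring

/-- **Uniqueness of the decaying pressure (Liouville)**: two bounded `C²` functions with the same
Laplacian, both tending to `0` at infinity, coincide — in the decaying class the Poisson law determines
the pressure completely; there is nothing to choose. [cite: GilbargTrudinger2001, Thm 2.10] -/
theorem eq_of_laplacian_eq_of_tendsto_zero {E : Type*} [NormedAddCommGroup E] [InnerProductSpace ℝ E]
    [FiniteDimensional ℝ E] [MeasurableSpace E] [BorelSpace E] [Nontrivial E] {p p' : E → ℝ}
    (hp : ContDiff ℝ 2 p) (hp' : ContDiff ℝ 2 p') (hΔ : ∀ x, (Δ p) x = (Δ p') x)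
    (hb : ∃ C, ∀ x, |p x| ≤ C) (hb' : ∃ C, ∀ x, |p' x| ≤ C)
    (h0 : Tendsto p (cocompact E) (𝓝 0)) (h0' : Tendsto p' (cocompact E) (𝓝 0)) : p = p' := by
  obtain ⟨C, hC⟩ := hb
  obtain ⟨C', hC'⟩ := hb'
  have hΔ0 : Δ (p - p') = 0 := by
    funext x
    rw [hp.contDiffAt.laplacian_sub hp'.contDiffAt, hΔ x, sub_self, Pi.zero_apply]
  have hharm : HarmonicOnNhd (p - p') univ := fun x _ => ⟨(hp.sub hp').contDiffAt, by rw [hΔ0]⟩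
  have hbdd : ∃ B, ∀ x, |(p - p') x| ≤ B :=
    ⟨C + C', fun x => (abs_sub (p x) (p' x)).trans (add_le_add (hC x) (hC' x))⟩
  have hconst := isConst_of_harmonic_bounded hharm hbdd
  have hlim : Tendsto (p - p') (cocompact E) (𝓝 0) := by
    have h := h0.sub h0'
    rw [sub_zero] at h
    exact h
  have hc : (p - p') = fun _ => (p - p') 0 := funext fun x => hconst x 0
  rw [hc] at hlim
  have h00 : (p - p') 0 = 0 := tendsto_nhds_unique tendsto_const_nhds hlim
  funext x
  have hx := hconst x 0
  rwa [h00, Pi.sub_apply, sub_eq_zero] at hx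

end PressureSlaving

open PressureSlaving Literature.Analysis.FluidPDE Literature.Analysis.FluidPDE.TaylorGreenVortex

/-- **Barrier (method-level lemma): the pressure is slaved to the velocity and cannot be set to zero /
declared harmonic / prescribed; in the decaying class it is unique.**

BARRIER (structured block, D-0021):
technique_class: pressure-elimination p-equals-zero-wlog harmonic-pressure-for-all-flows lagrangian-coordinates-pressure-drop bernoulli-potential-absorption pressureless-burgers-reduction maximum-principle-for-velocity exact-general-solution-by-potential
blocks: arguments for NavierStokesRegularity (existence/smoothness with «p = 0», maximum principle `‖v(t)‖_∞ ≤ ‖v₀‖_∞`, or «exact general solutions») whose decisive step removes the pressure — «Δ(p+u) = 0 … Δp = 0, ∇p|_∞ = 0 ⟹ p = const, положим p = 0» after passing to Lagrangian variables, or `∇p := −∇φ − ½∇|u|²` with a prescribed potential, or any «without loss of generality p ≡ 0» — and then solves a pressureless parabolic system; instance under adjudication C113 `Baev2022` ((12) p.8, Cor. 1 (15) p.9, Cor. 2 p.10, Thm 3 p.15; skeleton `Literature.Claims.NS.Baev2022`: `Eq12`, `NeumannLiouville` (TRUE, `….Theorems.Baev2022.step2_neumannLiouville_holds`), `Cor2`,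 `PressureFreeExistence`, `DivFreePersists`) [cite: Baev2022ru, (12) p.8; Следствие 1 (15) p.9; Следствие 2 p.10; Теорема 3 p.15].
because: divergence of the momentum equation of a divergence-free classical solution: `−Δp = div((u·∇)u) = tr (∇u)²` [cite: MajdaBertozziCUP2002, §1.8 (1.84)] (tree `laplacian_pressure_eq_of_isClassicalNSSolutionOn`, `divergence_convect_self_eq`); the source is non-zero for generic divergence-free fields — kernel `divergence_convect_taylorGreen_origin` (= 2), `laplacian_eq_neg_two_of_balances`, `not_exists_harmonic_pressure_taylorGreen`, `laplacian_pressure_taylorGreen_origin`; in the decaying class the Poisson law has exactly one bounded solution vanishing at infinity — kernel `eq_of_laplacian_eq_of_tendsto_zero` (Liouville [cite: GilbargTrudinger2001, Thm 2.10]); dropping `∇p` changes the PDE: the pressureless flow leaves `{div v = 0}` instantly — kernel `divFree_not_preserved_formal` (`∂ₜ div v|₀ = −2` at the Taylor–Green datum).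
evasions_known: (a) SPECIAL SUB-CLASSES where the pressure genuinely decouples — parallel/unidirectional shear flows and 2½-D flows built on them (`tr (∇u)² ≡ 0`, heat-equation dynamics), potential flows, Beltrami/Trkalian families with Bernoulli pressure `p = −|u|²/2 + const` (tree `BeltramiFlows`): claims living there are «wrong problem (special data class)», not general-data results; (b) the projected (Leray) formulation eliminates `p` honestly by `ℙ`, a NON-LOCAL zeroth-order operator — no maximum principle survives it (cf. `SupNormGainObstruction` for the symbol-vs-sup-norm gap); (c) gauge freedom `p ↦ p + c(t)` (and `+ a(t)·x` without decay, `UnnormalisedPressureLoophole`) is the whole residual freedom.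
scope_caveats: (i) the kernel witness is the (periodic, non-decaying) Taylor–Green datum at `t = 0` — enough to refute «for every flow» statements and formal `∂ₜ div` claims; a Schwartz-class witness (e.g. a localized vortex ring) is not formalised here; (ii) `divFree_not_preserved_formal` is the formal first time-derivative, not a statement about the pressureless Cauchy problem's solutions; (iii) says nothing about NS blow-up or regularity.
status: established (proved here; tree Taylor–Green identities + Liouville)
[cite: MajdaBertozziCUP2002, §1.8 (1.84)] [cite: TaylorGreen1937, eqs. (15)–(17)] -/
def PressureSlaving : Prop :=
  (¬ ∃ q : EuclideanSpace ℝ (Fin 3) → ℝ, ContDiff ℝ 2 q ∧ (∀ x, (Δ q) x = 0) ∧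
      ∀ x, VectorCalculus.divergence (fun y => convect velocity velocity y + gradient q y) x = 0) ∧
  (∀ ν : ℝ, VectorCalculus.divergence (fun y => ν • (Δ velocity) y - convect velocity velocity y) 0 ≠ 0) ∧
  (∀ p p' : EuclideanSpace ℝ (Fin 3) → ℝ, ContDiff ℝ 2 p → ContDiff ℝ 2 p' → (∀ x, (Δ p) x = (Δ p') x) →
      (∃ C, ∀ x, |p x| ≤ C) → (∃ C, ∀ x, |p' x| ≤ C) →
      Tendsto p (cocompact _) (𝓝 0) → Tendsto p' (cocompact _) (𝓝 0) → p = p')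

/-- Discharge of the barrier statement. [cite: MajdaBertozziCUP2002, §1.8 (1.84)] -/
theorem pressureSlaving_holds : PressureSlaving :=
  ⟨not_exists_harmonic_pressure_taylorGreen,
    fun ν h => by rw [divFree_not_preserved_formal ν] at h; norm_num at h,
    fun _ _ hp hp' hΔ hb hb' h0 h0' => eq_of_laplacian_eq_of_tendsto_zero hp hp' hΔ hb hb' h0 h0'⟩

end Literature.Barriers.NavierStokesRegularity

end

-- WHAT THIS IS NOT: not a claim about NS regularity or blow-up; not a claim about any author beyond the typed locator.
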